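/-
Copyright (c) 2026 the pub-hodgecm-mathlib formalisation cell (harness21).  Prover seat hodgecm-mathlib-K2E3-p17 (g10), HCML Track B «K2-LIT» ∕ h413
(`stmt-HodgeConjecture-24833`), R90-TF section S3 hand S3-p11 «h3 → TWO SPARE COMPACT PLACES» (dealt BY NAME by R90-C12-plan (g0), 2026-09-04T22:10:11Z,
optional corollary (5) 22:12:21Z; LH7-typ2 (g0) carrier note 22:11:47Z).  2026-09-04.
-/
import Summits.HodgeConjecture.HodgeConjecture.Theorems.R90S2ArchKitHRowsDefs
import Summits.HodgeConjecture.HodgeConjecture.Theorems.F0P3XiArchDataOfRecord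
import Summits.HodgeConjecture.HodgeConjecture.Theorems.R90ThreeLeFinrankRealSubfieldOfSixLe
import HarnessLib

/-!
# R90-TF rung 0, junction brick #2 — `h3 : 3 ≤ [L⁺ : ℚ]` gives TWO DISTINCT COMPACT PLACES (and two spare embeddings)

Cell `pub/hodgecm-mathlib` (D-0151), Track B (21-frontier RULING «PUSH BOTH» 2026-09-03, director req624), seat K2E3-p17 (g10), section S3 (dealer
R90-C12-plan (g0)), hand S3-p11.  `--kind proof --supports stmt-HodgeConjecture-24833 --as helper`; THEOREMS ONLY (no definition ∕ instance ∕ notation ∕ named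
fact ∕ `sorry`); never imports `Cruxes/…/Lines`.

PURPOSE.  The by-name discharge EVERY two-place (`₂`) payer needs at the top of its proof: S7 DS₂ at `τ₁ ≠ τ₂` (JQ-S7-12 Q3 sockets), S10 `…tfBlocks₂`, S9-J7.
In S2 currency (★ `Theorems/R90S2ArchKitHDefs` :82) the compact places of the CM frame are the subtype
`R90.S2.CptPlace L ι = {w : InfinitePlace L // w ≠ InfinitePlace.mk ι}`, and ★ `R90.S2.card_cptPlace : Fintype.card (CptPlace L ι) = nCompactOfRecord L`
(`Theorems/R90S2ArchKitHRowsDefs` :135) with ★ `nCompactOfRecord_add_one L : nCompactOfRecord L + 1 = [L⁺ : ℚ]` (`Theorems/F0P3XiArchDataOfRecord` :269).  Hence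
the R-QS1-7 token `h3 : 3 ≤ [L⁺ : ℚ]` gives `#(CptPlace L ι) = [L⁺ : ℚ] − 1 ≥ 2`, i.e. two distinct compact places; the rung-0 hypothesis `h6 : 6 ≤ [L : ℚ]`
of `Hyp413` gives `h3` BY NAME through ★ `R90.three_le_finrank_maximalRealSubfield_of_six_le` (`Theorems/R90ThreeLeFinrankRealSubfieldOfSixLe`, p862329).
The S7 carrier of record for O2″ ∕ `QsRigidCore₂` is stated in EMBEDDINGS `(ι₁ ι₂ : L →+* ℂ) (hι : InfinitePlace.mk ι₁ ≠ InfinitePlace.mk ι₂)` (S2-R16 (B) Q3);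
§3 bridges to it with Mathlib ★ `NumberField.InfinitePlace.mk_embedding`.

CONTENT (size S, ≤ 70 lines of Lean).
* §1 `one_lt_card_cptPlace_of_three_le`, `exists_pair_cptPlace_of_three_le`, `nontrivial_cptPlace_of_three_le` (binders = the R-QS1-7 token VERBATIM).
* §2 the rung-0 twins from `h6 : 6 ≤ Module.finrank ℚ L`: `exists_pair_cptPlace_of_six_le`, `nontrivial_cptPlace_of_six_le`.
* §3 S7 currency: `exists_pair_embedding_of_three_le`, `exists_pair_embedding_of_six_le` — two embeddings whose places are distinct from each other and from `mk ι`.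

HONEST LABEL: plumbing (a cardinality count) — it proves nothing printed; HC_CM is proved only modulo the 7 printed citations (2 remaining named inputs:
hLiu418 = stmt-HodgeConjecture-24832, h413 = stmt-HodgeConjecture-24833) until rung 0 closes; count-neutral helper.  ZERO `sorry`; default heartbeats.

References: [Rogawski1990] §14.6 p. 244 (`N = Card(S₀)`, the compact real places of `L⁺`), §14.4 p. 236.
-/

set_option autoImplicit false
-- the mandated namespace repeats the single-problem summit's segment (`HodgeConjecture.HodgeConjecture`)
set_option linter.dupNamespace false

namespace Summit.HodgeConjecture.HodgeConjecture.R90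

open NumberField
open scoped Classical
open Summit.HodgeConjecture.HodgeConjecture.Cruxes.H413.F0P3XiArchDataOfRecord (nCompactOfRecord nCompactOfRecord_add_one)

/-! ## §1 From the token `h3 : 3 ≤ [L⁺ : ℚ]` (R-QS1-7) [§14.6 p. 244] -/

/-- **Two compact places from `h3`.**  `#(CptPlace L ι) = nCompactOfRecord L = [L⁺ : ℚ] − 1 ≥ 2 > 1` (★ `S2.card_cptPlace`, ★ `nCompactOfRecord_add_one`).
[cite: Rogawski1990, §14.6 p. 244] -/
theorem one_lt_card_cptPlace_of_three_le (L : Type) [Field L] [NumberField L] [IsCMField L] (ι : L →+* ℂ)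
    (h3 : 3 ≤ Module.finrank ℚ ↥(maximalRealSubfield L)) : 1 < Fintype.card (S2.CptPlace L ι) := by
  -- `convert` absorbs any difference in the (subsingleton) `Fintype` instance path of the subtype
  have hcard : Fintype.card (S2.CptPlace L ι) = nCompactOfRecord L := by convert S2.card_cptPlace L ι
  have hadd : nCompactOfRecord L + 1 = Module.finrank ℚ ↥(maximalRealSubfield L) := nCompactOfRecord_add_one L
  omega

/-- **A pair of distinct compact places from `h3`** (Mathlib `Fintype.exists_pair_of_one_lt_card`). [cite: Rogawski1990, §14.6 p. 244] -/
theorem exists_pair_cptPlace_of_three_le (L : Type) [Field L] [NumberField L] [IsCMField L] (ι : L →+* ℂ)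
    (h3 : 3 ≤ Module.finrank ℚ ↥(maximalRealSubfield L)) : ∃ w₁ w₂ : S2.CptPlace L ι, w₁ ≠ w₂ :=
  Fintype.exists_pair_of_one_lt_card (one_lt_card_cptPlace_of_three_le L ι h3)

/-- **`CptPlace L ι` is nontrivial under `h3`** (Mathlib `Fintype.one_lt_card_iff_nontrivial`). [cite: Rogawski1990, §14.6 p. 244] -/
theorem nontrivial_cptPlace_of_three_le (L : Type) [Field L] [NumberField L] [IsCMField L] (ι : L →+* ℂ)
    (h3 : 3 ≤ Module.finrank ℚ ↥(maximalRealSubfield L)) : Nontrivial (S2.CptPlace L ι) :=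
  Fintype.one_lt_card_iff_nontrivial.mp (one_lt_card_cptPlace_of_three_le L ι h3)

/-! ## §2 Rung-0 twins from `h6 : 6 ≤ [L : ℚ]` (`Hyp413`), composed BY NAME through ★ `three_le_finrank_maximalRealSubfield_of_six_le` -/

/-- **A pair of distinct compact places from `h6 : 6 ≤ [L : ℚ]`** (★ `three_le_finrank_maximalRealSubfield_of_six_le` then §1). [cite: Rogawski1990, §14.6 p. 244] -/
theorem exists_pair_cptPlace_of_six_le (L : Type) [Field L] [NumberField L] [IsCMField L] (ι : L →+* ℂ)
    (h6 : 6 ≤ Module.finrank ℚ L) : ∃ w₁ w₂ : S2.CptPlace L ι, w₁ ≠ w₂ :=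
  exists_pair_cptPlace_of_three_le L ι (three_le_finrank_maximalRealSubfield_of_six_le L h6)

/-- **`CptPlace L ι` is nontrivial under `h6 : 6 ≤ [L : ℚ]`** (★ `three_le_finrank_maximalRealSubfield_of_six_le` then §1). [cite: Rogawski1990, §14.6 p. 244] -/
theorem nontrivial_cptPlace_of_six_le (L : Type) [Field L] [NumberField L] [IsCMField L] (ι : L →+* ℂ)
    (h6 : 6 ≤ Module.finrank ℚ L) : Nontrivial (S2.CptPlace L ι) :=
  nontrivial_cptPlace_of_three_le L ι (three_le_finrank_maximalRealSubfield_of_six_le L h6)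

/-! ## §3 S7 currency (S2-R16 (B) Q3): two spare EMBEDDINGS, bridged by Mathlib ★ `NumberField.InfinitePlace.mk_embedding` -/

/-- **Two embeddings `ι₁ ι₂ : L →+* ℂ` whose places are distinct from each other and from `mk ι`, from `h3`.**  Witnesses: `wᵢ.1.embedding` for a pair of
distinct compact places `w₁ ≠ w₂` (§1), using `InfinitePlace.mk w.embedding = w`. [cite: Rogawski1990, §14.6 p. 244] -/
theorem exists_pair_embedding_of_three_le (L : Type) [Field L] [NumberField L] [IsCMField L] (ι : L →+* ℂ)
    (h3 : 3 ≤ Module.finrank ℚ ↥(maximalRealSubfield L)) :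
    ∃ ι₁ ι₂ : L →+* ℂ, NumberField.InfinitePlace.mk ι₁ ≠ NumberField.InfinitePlace.mk ι₂ ∧
      NumberField.InfinitePlace.mk ι₁ ≠ NumberField.InfinitePlace.mk ι ∧ NumberField.InfinitePlace.mk ι₂ ≠ NumberField.InfinitePlace.mk ι := by
  obtain ⟨w₁, w₂, hne⟩ := exists_pair_cptPlace_of_three_le L ι h3
  refine ⟨w₁.1.embedding, w₂.1.embedding, ?_, ?_, ?_⟩
  · rw [InfinitePlace.mk_embedding, InfinitePlace.mk_embedding]
    exact fun h => hne (Subtype.ext h)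
  · rw [InfinitePlace.mk_embedding]
    exact w₁.2
  · rw [InfinitePlace.mk_embedding]
    exact w₂.2

/-- **Two spare embeddings from `h6 : 6 ≤ [L : ℚ]`** (★ `three_le_finrank_maximalRealSubfield_of_six_le` then `exists_pair_embedding_of_three_le`).
[cite: Rogawski1990, §14.6 p. 244] -/
theorem exists_pair_embedding_of_six_le (L : Type) [Field L] [NumberField L] [IsCMField L] (ι : L →+* ℂ)
    (h6 : 6 ≤ Module.finrank ℚ L) :
    ∃ ι₁ ι₂ : L →+* ℂ, NumberField.InfinitePlace.mk ι₁ ≠ NumberField.InfinitePlace.mk ι₂ ∧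
      NumberField.InfinitePlace.mk ι₁ ≠ NumberField.InfinitePlace.mk ι ∧ NumberField.InfinitePlace.mk ι₂ ≠ NumberField.InfinitePlace.mk ι :=
  exists_pair_embedding_of_three_le L ι (three_le_finrank_maximalRealSubfield_of_six_le L h6)

end Summit.HodgeConjecture.HodgeConjecture.R90
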